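import Mathlib
import HarnessLib

/-!
# HANDOFF — the PROFILE LOWER BOUND `Σ b_mσ^{2m}/(2m)! ≥ κ·Φ(pσ²)` from cumulant-size hypotheses (rh-explicit, track «HANDOFF», seat prove-2 gen10, ATTEMPT-19 §4)

HONEST FRAMING. Nothing here bears on the truth of RH; this is elementary real analysis on a power series, Mathlib-only (the profile
`Φ(x) = Σ xⁿ/(n!(2n)!)` = `HandoffDodgerProfileDefs.dodgerPhi` enters through a `HasSum` hypothesis, so this file has no tree dependency). It is ATTEMPT-16's Lemma D1 (profile control on the collar)
in PARAMETRIC form: the dodger enters only through a real sequence `b_m` (for the dodger: `b_m = (−1)^m·Re h_m`, `h` = the coefficients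
of the moment series `H = P̃/Λ̃`, so that `2b·Re F₀(b−σ)/c_∞ = Σ_m b_mσ^{2m}/(2m)!`) and the two SIZE hypotheses delivered by
`HandoffDodgerMajorant` + `HandoffDodgerNewton` + `HandoffDodgerPowerSums`:

  (H1) `|b_m − p^m/m!| ≤ (p^m/m!)·(exp(2PWm²/p²) − 1)` for `m ≤ N₂`   (main range, `W·N₂ ≤ p/2`),
  (H2) `|b_m| ≤ E·(2W)^m` for `m > N₂`                              (tail, `E = e^{(p+P)/(2W)}`).

THEOREM (`profile_lower_bound`): for `0 ≤ σ` with `pσ² ≤ X`, any sum `S` of `Σ_m b_mσ^{2m}/(2m)!` and any sum `Φ` of `Σ_m (pσ²)^m/(m!(2m)!)`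
(`= dodgerPhi (pσ²)` by `hasSum_dodgerPhi`),

  `S ≥ (1 − η − 3τ₁ − τ₂)·Φ`,

whenever `η ≥ exp(2PWN₁²/p²) − 1`, `λ ≥ 2PWN₂/p²`, `ρ₁ ≥ e^{3+λ}X/(4(N₁+1)³)`, `ρ₂ ≥ e²Wσ²/(2(N₂+1)²)`, `ρ₁, ρ₂ < 1`,
`τ₁ ≥ ρ₁^{N₁+1}/(1−ρ₁)`, `τ₂ ≥ E·ρ₂^{N₂+1}/(1−ρ₂)` (`N₁ ≤ N₂`; (H1) at `m = 0` forces `b_0 = 1`). PROOF: three ranges — `m ≤ N₁`: `b_mσ^{2m}/(2m)! ≥ (1−η)·term_m`;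
`N₁ < m ≤ N₂`: `|b_m|σ^{2m}/(2m)! ≤ term_m·e^{λm} ≤ ρ₁^m` by `m!(2m)! ≥ 4^m m^{3m}e^{−3m}` (`profileTerm_le_pow`); `m > N₂`:
`≤ E(2Wσ²)^m/(2m)! ≤ Eρ₂^m` by `(2m)! ≥ (2m/e)^{2m}`; geometric tails; limit of partial sums (`ge_of_tendsto`). All constants are
free parameters bounded by INEQUALITIES, so the assembly may feed crude upper bounds. No `sorry`, standard axioms, no definitions.

References: this track (ATTEMPT-16 §5 Lemma D1; ATTEMPT-19 §4). Folklore.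
-/

set_option linter.dupNamespace false

noncomputable section

open Finset Real Filter
open scoped Topology

namespace Summit.RiemannHypothesis.RiemannHypothesis.Theorems.Handoff

/-! ## Factorial inequalities -/

/-- `(2m)^{2m} ≤ e^{2m}·(2m)!` (from `xⁿ/n! ≤ eˣ` at `x = n`; the case `n = m` of the same inequality is the tree's
`Literature.…Graham2010.pow_self_le_exp_mul_factorial`, restated locally inside the proofs below). [folklore] -/
theorem pow_self_le_exp_mul_factorial_two_mul (m : ℕ) :
    (2 * (m : ℝ)) ^ (2 * m) ≤ Real.exp 1 ^ (2 * m) * ((2 * m).factorial : ℝ) := by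
  have h := Real.pow_div_factorial_le_exp (((2 * m : ℕ)) : ℝ) (Nat.cast_nonneg _) (2 * m)
  have hf : (0 : ℝ) < ((2 * m).factorial : ℝ) := by exact_mod_cast Nat.factorial_pos (2 * m)
  rw [div_le_iff₀ hf, ← Real.exp_one_pow] at h
  push_cast at h
  exact h

/-- `term_m(x) = (p^m/m!)·σ^{2m}/(2m)!` at `x = pσ²` (`term_m(x) = x^m/(m!(2m)!)`). [this track, ATTEMPT-16 §5] -/
theorem profileTerm_mul_sq (p σ : ℝ) (m : ℕ) :
    (p * σ ^ 2) ^ m / ((m.factorial : ℝ) * ((2 * m).factorial : ℝ)) =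
      p ^ m / (m.factorial : ℝ) * (σ ^ (2 * m) / ((2 * m).factorial : ℝ)) := by
  rw [mul_pow, ← pow_mul]
  ring

/-- **`term_m(x) ≤ (e³x/(4m³))^m`** for `m ≥ 1`, `x ≥ 0`. [this track, ATTEMPT-16 §5 Lemma D1 (iii)] -/
theorem profileTerm_le_pow {x : ℝ} (hx : 0 ≤ x) {m : ℕ} (hm : 1 ≤ m) :
    x ^ m / ((m.factorial : ℝ) * ((2 * m).factorial : ℝ)) ≤ (Real.exp 3 * x / (4 * (m : ℝ) ^ 3)) ^ m := by
  have hm0 : (0 : ℝ) < m := by exact_mod_cast hm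
  have hf1 : (0 : ℝ) < (m.factorial : ℝ) := by exact_mod_cast Nat.factorial_pos m
  have hf2 : (0 : ℝ) < ((2 * m).factorial : ℝ) := by exact_mod_cast Nat.factorial_pos (2 * m)
  have h1 : (m : ℝ) ^ m ≤ Real.exp 1 ^ m * (m.factorial : ℝ) := by
    have h := Real.pow_div_factorial_le_exp (m : ℝ) (Nat.cast_nonneg m) m
    rwa [div_le_iff₀ hf1, ← Real.exp_one_pow] at h
  have h2 := pow_self_le_exp_mul_factorial_two_mul m
  -- `4^m m^{3m} = m^m (2m)^{2m} ≤ e^{3m} m! (2m)!`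
  have hprod : (4 * (m : ℝ) ^ 3) ^ m ≤ Real.exp 3 ^ m * ((m.factorial : ℝ) * ((2 * m).factorial : ℝ)) := by
    have e1 : (4 * (m : ℝ) ^ 3) ^ m = (m : ℝ) ^ m * (2 * (m : ℝ)) ^ (2 * m) := by
      rw [mul_pow, pow_mul, ← mul_pow, ← mul_pow]; ring
    have e3 : Real.exp 3 = Real.exp 1 ^ 3 := by rw [Real.exp_one_pow]; norm_num
    have e2 : Real.exp 3 ^ m = Real.exp 1 ^ m * Real.exp 1 ^ (2 * m) := by
      rw [e3, ← pow_mul, ← pow_add]; congr 1; ring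
    rw [e1, e2]
    calc (m : ℝ) ^ m * (2 * (m : ℝ)) ^ (2 * m)
        ≤ (Real.exp 1 ^ m * (m.factorial : ℝ)) * (Real.exp 1 ^ (2 * m) * ((2 * m).factorial : ℝ)) :=
          mul_le_mul h1 h2 (by positivity) (by positivity)
      _ = Real.exp 1 ^ m * Real.exp 1 ^ (2 * m) * ((m.factorial : ℝ) * ((2 * m).factorial : ℝ)) := by ring
  rw [div_pow, mul_pow, div_le_div_iff₀ (by positivity) (by positivity)]
  calc x ^ m * (4 * (m : ℝ) ^ 3) ^ m ≤ x ^ m * (Real.exp 3 ^ m * ((m.factorial : ℝ) * ((2 * m).factorial : ℝ))) :=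
        mul_le_mul_of_nonneg_left hprod (pow_nonneg hx m)
    _ = Real.exp 3 ^ m * x ^ m * ((m.factorial : ℝ) * ((2 * m).factorial : ℝ)) := by ring

set_option maxHeartbeats 400000 in
/-- `(2Wσ²)^m/(2m)! ≤ (e²Wσ²/(2m²))^m` for `m ≥ 1`. [this track, ATTEMPT-19 §4] -/
theorem pow_div_factorial_two_mul_le {W σ : ℝ} (hW : 0 ≤ W) {m : ℕ} (hm : 1 ≤ m) :
    (2 * W * σ ^ 2) ^ m / ((2 * m).factorial : ℝ) ≤ (Real.exp 2 * W * σ ^ 2 / (2 * (m : ℝ) ^ 2)) ^ m := by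
  have hm0 : (0 : ℝ) < m := by exact_mod_cast hm
  have hf2 : (0 : ℝ) < ((2 * m).factorial : ℝ) := by exact_mod_cast Nat.factorial_pos (2 * m)
  have h2 := pow_self_le_exp_mul_factorial_two_mul m
  have e3 : Real.exp 2 = Real.exp 1 ^ 2 := by rw [Real.exp_one_pow]; norm_num
  rw [div_pow, div_le_div_iff₀ hf2 (by positivity)]
  calc (2 * W * σ ^ 2) ^ m * (2 * (m : ℝ) ^ 2) ^ m = (W * σ ^ 2) ^ m * (2 * (m : ℝ)) ^ (2 * m) := by
        rw [pow_mul (2 * (m : ℝ)) 2 m, ← mul_pow, ← mul_pow]; congr 1; ring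
    _ ≤ (W * σ ^ 2) ^ m * (Real.exp 1 ^ (2 * m) * ((2 * m).factorial : ℝ)) :=
        mul_le_mul_of_nonneg_left h2 (by positivity)
    _ = (Real.exp 2 * W * σ ^ 2) ^ m * ((2 * m).factorial : ℝ) := by
        rw [e3, pow_mul (Real.exp 1) 2 m, mul_assoc (Real.exp 1 ^ 2), mul_pow (Real.exp 1 ^ 2)]; ring

/-! ## The profile lower bound -/

set_option maxHeartbeats 400000 in
/-- **ATTEMPT-16 Lemma D1, parametric form.** See the module docstring. [this track, ATTEMPT-16 §5 Lemma D1; ATTEMPT-19 §4] -/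
theorem profile_lower_bound {b : ℕ → ℝ} {p W P X σ E η lam ρ₁ ρ₂ τ₁ τ₂ : ℝ} {N₁ N₂ : ℕ}
    (hp : 0 < p) (hW : 0 ≤ W) (hP : 0 ≤ P) (hE : 0 ≤ E) (hN : N₁ ≤ N₂)
    (H1 : ∀ m : ℕ, m ≤ N₂ →
      |b m - p ^ m / (m.factorial : ℝ)| ≤ p ^ m / (m.factorial : ℝ) * (Real.exp (2 * P * W * (m : ℝ) ^ 2 / p ^ 2) - 1))
    (H2 : ∀ m : ℕ, N₂ < m → |b m| ≤ E * (2 * W) ^ m)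
    (hσ : 0 ≤ σ) (hσX : p * σ ^ 2 ≤ X)
    (hη : Real.exp (2 * P * W * (N₁ : ℝ) ^ 2 / p ^ 2) - 1 ≤ η) (hlam : 2 * P * W * (N₂ : ℝ) / p ^ 2 ≤ lam)
    (hρ₁ : Real.exp (3 + lam) * X / (4 * ((N₁ : ℝ) + 1) ^ 3) ≤ ρ₁) (hρ₁1 : ρ₁ < 1)
    (hρ₂ : Real.exp 2 * W * σ ^ 2 / (2 * ((N₂ : ℝ) + 1) ^ 2) ≤ ρ₂) (hρ₂1 : ρ₂ < 1)
    (hτ₁ : ρ₁ ^ (N₁ + 1) / (1 - ρ₁) ≤ τ₁) (hτ₂ : E * ρ₂ ^ (N₂ + 1) / (1 - ρ₂) ≤ τ₂)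
    {S : ℝ} (hS : HasSum (fun m : ℕ => b m * σ ^ (2 * m) / ((2 * m).factorial : ℝ)) S)
    {Φ : ℝ} (hΦ : HasSum (fun m : ℕ => (p * σ ^ 2) ^ m / ((m.factorial : ℝ) * ((2 * m).factorial : ℝ))) Φ) :
    (1 - η - 3 * τ₁ - τ₂) * Φ ≤ S := by
  -- notation
  set x := p * σ ^ 2 with hx
  have hx0 : 0 ≤ x := by positivity
  have hX0 : 0 ≤ X := hx0.trans hσX
  set κ := 1 - η - 3 * τ₁ - τ₂ with hκ
  set f : ℕ → ℝ := fun m => b m * σ ^ (2 * m) / ((2 * m).factorial : ℝ) with hf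
  set t : ℕ → ℝ := fun m => x ^ m / ((m.factorial : ℝ) * ((2 * m).factorial : ℝ)) with ht
  have hlam0 : 0 ≤ lam := le_trans (by positivity) hlam
  have hρ₁0 : 0 ≤ ρ₁ := le_trans (by positivity) hρ₁
  have hρ₂0 : 0 ≤ ρ₂ := le_trans (by positivity) hρ₂
  have hη0 : 0 ≤ η := le_trans (by linarith [Real.one_le_exp (by positivity : (0:ℝ) ≤ 2 * P * W * (N₁ : ℝ) ^ 2 / p ^ 2)]) hη
  have hτ₁0 : 0 ≤ τ₁ := le_trans (div_nonneg (pow_nonneg hρ₁0 _) (by linarith)) hτ₁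
  have hτ₂0 : 0 ≤ τ₂ := le_trans (div_nonneg (mul_nonneg hE (pow_nonneg hρ₂0 _)) (by linarith)) hτ₂
  have hκ1 : κ ≤ 1 := by simp only [hκ]; linarith
  have ht0 : ∀ m, 0 ≤ t m := fun m => by positivity
  -- the term identity `t m = (p^m/m!)·σ^{2m}/(2m)!`
  have htm : ∀ m, t m = p ^ m / (m.factorial : ℝ) * (σ ^ (2 * m) / ((2 * m).factorial : ℝ)) :=
    fun m => profileTerm_mul_sq p σ m
  -- (A) main range: `|f m − t m| ≤ t m·(e^{g_m} − 1)` for `m ≤ N₂`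
  have hA : ∀ m, m ≤ N₂ → |f m - t m| ≤ t m * (Real.exp (2 * P * W * (m : ℝ) ^ 2 / p ^ 2) - 1) := by
    intro m hm
    have hw : 0 ≤ σ ^ (2 * m) / ((2 * m).factorial : ℝ) := by positivity
    have e : f m - t m = (b m - p ^ m / (m.factorial : ℝ)) * (σ ^ (2 * m) / ((2 * m).factorial : ℝ)) := by
      simp only [hf, htm]; ring
    rw [e, abs_mul, abs_of_nonneg hw, htm m]
    calc |b m - p ^ m / (m.factorial : ℝ)| * (σ ^ (2 * m) / ((2 * m).factorial : ℝ))
        ≤ p ^ m / (m.factorial : ℝ) * (Real.exp (2 * P * W * (m : ℝ) ^ 2 / p ^ 2) - 1) *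
            (σ ^ (2 * m) / ((2 * m).factorial : ℝ)) := mul_le_mul_of_nonneg_right (H1 m hm) hw
      _ = p ^ m / (m.factorial : ℝ) * (σ ^ (2 * m) / ((2 * m).factorial : ℝ)) *
            (Real.exp (2 * P * W * (m : ℝ) ^ 2 / p ^ 2) - 1) := by ring
  -- (A1) `m ≤ N₁`: `f m ≥ (1 − η)·t m`
  have hA1 : ∀ m, m ≤ N₁ → (1 - η) * t m ≤ f m := by
    intro m hm
    have h := hA m (hm.trans hN)
    have hg : Real.exp (2 * P * W * (m : ℝ) ^ 2 / p ^ 2) - 1 ≤ η := by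
      refine le_trans ?_ hη
      have hmr : (m : ℝ) ≤ N₁ := by exact_mod_cast hm
      have : (m : ℝ) ^ 2 ≤ (N₁ : ℝ) ^ 2 := by gcongr
      gcongr
    have h' := (abs_le.1 h).1
    nlinarith [ht0 m, mul_le_mul_of_nonneg_left hg (ht0 m)]
  -- (A2) `N₁ < m ≤ N₂`: `|f m| ≤ t m · e^{λ m} ≤ ρ₁^m`, and `t m ≤ ρ₁^m`
  have htρ : ∀ m, N₁ < m → t m * Real.exp (lam * m) ≤ ρ₁ ^ m ∧ t m ≤ ρ₁ ^ m := by
    intro m hm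
    have hm1 : 1 ≤ m := by omega
    have hm0 : (0 : ℝ) < m := by exact_mod_cast hm1
    have hmN : ((N₁ : ℝ) + 1) ≤ m := by exact_mod_cast hm
    have h1 : t m ≤ (Real.exp 3 * x / (4 * (m : ℝ) ^ 3)) ^ m := profileTerm_le_pow hx0 hm1
    -- the base `e³x/(4m³)·e^λ ≤ ρ₁`
    have hbase : Real.exp 3 * x / (4 * (m : ℝ) ^ 3) * Real.exp lam ≤ ρ₁ := by
      refine le_trans ?_ hρ₁
      rw [Real.exp_add]
      have hm3 : ((N₁ : ℝ) + 1) ^ 3 ≤ (m : ℝ) ^ 3 := by gcongr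
      calc Real.exp 3 * x / (4 * (m : ℝ) ^ 3) * Real.exp lam
          = Real.exp 3 * Real.exp lam * x / (4 * (m : ℝ) ^ 3) := by ring
        _ ≤ Real.exp 3 * Real.exp lam * X / (4 * (m : ℝ) ^ 3) := by gcongr
        _ ≤ Real.exp 3 * Real.exp lam * X / (4 * ((N₁ : ℝ) + 1) ^ 3) := by
            apply div_le_div_of_nonneg_left (by positivity) (by positivity)
            linarith
    have hbase0 : 0 ≤ Real.exp 3 * x / (4 * (m : ℝ) ^ 3) := by positivity
    have hbase' : Real.exp 3 * x / (4 * (m : ℝ) ^ 3) ≤ ρ₁ :=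
      le_trans (le_mul_of_one_le_right hbase0 (Real.one_le_exp hlam0)) hbase
    constructor
    · rw [show Real.exp (lam * m) = Real.exp lam ^ m by rw [← Real.exp_nat_mul]; ring_nf]
      calc t m * Real.exp lam ^ m ≤ (Real.exp 3 * x / (4 * (m : ℝ) ^ 3)) ^ m * Real.exp lam ^ m :=
            mul_le_mul_of_nonneg_right h1 (by positivity)
        _ = (Real.exp 3 * x / (4 * (m : ℝ) ^ 3) * Real.exp lam) ^ m := by rw [mul_pow]
        _ ≤ ρ₁ ^ m := pow_le_pow_left₀ (by positivity) hbase m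
    · exact h1.trans (pow_le_pow_left₀ hbase0 hbase' m)
  have hA2 : ∀ m, N₁ < m → m ≤ N₂ → -(2 * ρ₁ ^ m) ≤ f m - κ * t m := by
    intro m hm1 hm2
    have h := hA m hm2
    obtain ⟨hρa, hρb⟩ := htρ m hm1
    have hg : Real.exp (2 * P * W * (m : ℝ) ^ 2 / p ^ 2) ≤ Real.exp (lam * m) := by
      apply Real.exp_le_exp.2
      have hm0 : (0 : ℝ) ≤ m := Nat.cast_nonneg m
      have : (m : ℝ) ^ 2 ≤ (N₂ : ℝ) * m := by
        rw [sq]; exact mul_le_mul_of_nonneg_right (by exact_mod_cast hm2) hm0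
      calc 2 * P * W * (m : ℝ) ^ 2 / p ^ 2 ≤ 2 * P * W * ((N₂ : ℝ) * m) / p ^ 2 := by gcongr
        _ = 2 * P * W * (N₂ : ℝ) / p ^ 2 * m := by ring
        _ ≤ lam * m := mul_le_mul_of_nonneg_right hlam hm0
    -- `|f m| ≤ t m · e^{g_m} ≤ t m · e^{λm} ≤ ρ₁^m`
    have hfabs : |f m| ≤ ρ₁ ^ m := by
      have h1 : |f m| ≤ |f m - t m| + |t m| := by
        have := abs_add_le (f m - t m) (t m); rwa [sub_add_cancel] at this
      rw [abs_of_nonneg (ht0 m)] at h1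
      have h2 : |f m - t m| + t m ≤ t m * Real.exp (2 * P * W * (m : ℝ) ^ 2 / p ^ 2) := by nlinarith [ht0 m]
      have h3 : t m * Real.exp (2 * P * W * (m : ℝ) ^ 2 / p ^ 2) ≤ t m * Real.exp (lam * m) :=
        mul_le_mul_of_nonneg_left hg (ht0 m)
      linarith
    have hκt : κ * t m ≤ ρ₁ ^ m := le_trans (mul_le_of_le_one_left (ht0 m) hκ1) hρb
    have := neg_abs_le (f m)
    linarith
  -- (A3) `m > N₂`: `|f m| ≤ E·ρ₂^m`, `t m ≤ ρ₁^m`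
  have hA3 : ∀ m, N₂ < m → -(ρ₁ ^ m + E * ρ₂ ^ m) ≤ f m - κ * t m := by
    intro m hm
    have hm1 : 1 ≤ m := by omega
    have hmN : ((N₂ : ℝ) + 1) ≤ m := by exact_mod_cast hm
    obtain ⟨_, hρb⟩ := htρ m (lt_of_le_of_lt hN hm)
    have hκt : κ * t m ≤ ρ₁ ^ m := le_trans (mul_le_of_le_one_left (ht0 m) hκ1) hρb
    have hfabs : |f m| ≤ E * ρ₂ ^ m := by
      have hf2 : (0 : ℝ) < ((2 * m).factorial : ℝ) := by positivity
      have e : |f m| = |b m| * (σ ^ (2 * m) / ((2 * m).factorial : ℝ)) := by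
        simp only [hf]
        rw [abs_div, abs_mul, abs_of_nonneg (pow_nonneg hσ _), abs_of_pos hf2, mul_div_assoc]
      rw [e]
      have hw : 0 ≤ σ ^ (2 * m) / ((2 * m).factorial : ℝ) := by positivity
      calc |b m| * (σ ^ (2 * m) / ((2 * m).factorial : ℝ)) ≤ E * (2 * W) ^ m * (σ ^ (2 * m) / ((2 * m).factorial : ℝ)) :=
            mul_le_mul_of_nonneg_right (H2 m hm) hw
        _ = E * ((2 * W * σ ^ 2) ^ m / ((2 * m).factorial : ℝ)) := by
            rw [mul_pow, mul_pow, ← pow_mul]; ring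
        _ ≤ E * (Real.exp 2 * W * σ ^ 2 / (2 * (m : ℝ) ^ 2)) ^ m :=
            mul_le_mul_of_nonneg_left (pow_div_factorial_two_mul_le hW hm1) hE
        _ ≤ E * ρ₂ ^ m := by
            refine mul_le_mul_of_nonneg_left (pow_le_pow_left₀ (by positivity) ?_ m) hE
            refine le_trans ?_ hρ₂
            apply div_le_div_of_nonneg_left (by positivity) (by positivity)
            have : ((N₂ : ℝ) + 1) ^ 2 ≤ (m : ℝ) ^ 2 := by gcongr
            linarith
    have := neg_abs_le (f m)
    linarith
  -- partial sums from `N₂ + 1` on are `≥ 0`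
  have hpartial : ∀ M : ℕ, N₂ + 1 ≤ M → 0 ≤ ∑ m ∈ Finset.range M, (f m - κ * t m) := by
    intro M hM
    rw [← Finset.sum_range_add_sum_Ico _ hM, ← Finset.sum_range_add_sum_Ico _ (Nat.succ_le_succ hN)]
    -- block 1: `m ≤ N₁`
    have hB1 : (1 - η - κ) ≤ ∑ m ∈ Finset.range (N₁ + 1), (f m - κ * t m) := by
      have h1 : ∀ m ∈ Finset.range (N₁ + 1), (1 - η - κ) * t m ≤ f m - κ * t m := by
        intro m hm
        have := hA1 m (Nat.lt_succ_iff.1 (Finset.mem_range.1 hm))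
        nlinarith [ht0 m]
      refine le_trans ?_ (Finset.sum_le_sum h1)
      rw [← Finset.mul_sum]
      have hsum : t 0 ≤ ∑ m ∈ Finset.range (N₁ + 1), t m :=
        Finset.single_le_sum (fun m _ => ht0 m) (Finset.mem_range.2 (Nat.succ_pos N₁))
      have ht00 : t 0 = 1 := by simp [ht]
      have hc : 0 ≤ 1 - η - κ := by simp only [hκ]; linarith
      nlinarith
    -- block 2: `N₁ < m ≤ N₂`
    have hB2 : -(2 * (ρ₁ ^ (N₁ + 1) / (1 - ρ₁))) ≤ ∑ m ∈ Finset.Ico (N₁ + 1) (N₂ + 1), (f m - κ * t m) := by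
      have h1 : ∀ m ∈ Finset.Ico (N₁ + 1) (N₂ + 1), -(2 * ρ₁ ^ m) ≤ f m - κ * t m := by
        intro m hm
        obtain ⟨hm1, hm2⟩ := Finset.mem_Ico.1 hm
        exact hA2 m (by omega) (by omega)
      refine le_trans ?_ (Finset.sum_le_sum h1)
      rw [Finset.sum_neg_distrib, ← Finset.mul_sum, neg_le_neg_iff]
      exact mul_le_mul_of_nonneg_left (geom_sum_Ico_le_of_lt_one hρ₁0 hρ₁1) (by norm_num)
    -- block 3: `m > N₂`
    have hB3 : -(ρ₁ ^ (N₁ + 1) / (1 - ρ₁) + E * (ρ₂ ^ (N₂ + 1) / (1 - ρ₂))) ≤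
        ∑ m ∈ Finset.Ico (N₂ + 1) M, (f m - κ * t m) := by
      have h1 : ∀ m ∈ Finset.Ico (N₂ + 1) M, -(ρ₁ ^ m + E * ρ₂ ^ m) ≤ f m - κ * t m := by
        intro m hm
        exact hA3 m (by have := (Finset.mem_Ico.1 hm).1; omega)
      refine le_trans ?_ (Finset.sum_le_sum h1)
      rw [Finset.sum_neg_distrib, Finset.sum_add_distrib, ← Finset.mul_sum, neg_le_neg_iff]
      have g1 : ∑ m ∈ Finset.Ico (N₂ + 1) M, ρ₁ ^ m ≤ ρ₁ ^ (N₁ + 1) / (1 - ρ₁) := by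
        refine (geom_sum_Ico_le_of_lt_one hρ₁0 hρ₁1).trans ?_
        exact div_le_div_of_nonneg_right (pow_le_pow_of_le_one hρ₁0 hρ₁1.le (by omega)) (by linarith)
      have g2 : ∑ m ∈ Finset.Ico (N₂ + 1) M, ρ₂ ^ m ≤ ρ₂ ^ (N₂ + 1) / (1 - ρ₂) := geom_sum_Ico_le_of_lt_one hρ₂0 hρ₂1
      linarith [mul_le_mul_of_nonneg_left g2 hE]
    have hsum1 : 1 - η - κ = 3 * τ₁ + τ₂ := by simp only [hκ]; ring
    have hE' : E * (ρ₂ ^ (N₂ + 1) / (1 - ρ₂)) ≤ τ₂ := by rw [← mul_div_assoc]; exact hτ₂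
    refine le_trans ?_ (add_le_add (add_le_add hB1 hB2) hB3)
    linarith only [hsum1, hE', hτ₁]
  -- pass to the limit
  have hlim : Tendsto (fun M : ℕ => ∑ m ∈ Finset.range M, (f m - κ * t m)) atTop (𝓝 (S - κ * Φ)) := by
    have h1 := hS.tendsto_sum_nat
    have h2 := (hΦ.mul_left κ).tendsto_sum_nat
    have h3 := h1.sub h2
    refine h3.congr fun M => ?_
    rw [Finset.sum_sub_distrib]
  have hfin := ge_of_tendsto hlim (Filter.eventually_atTop.2 ⟨N₂ + 1, hpartial⟩)
  linarith only [hfin]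

end Summit.RiemannHypothesis.RiemannHypothesis.Theorems.Handoff

end
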